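/-
COR-CM (cell pub-hodgecm2, stage 2 of the Hodge ladder) — count-neutral KERNEL COMBINATORICS «the sheared dihedral family», part XI: gen 44ʼs value
vectors under the motion of `s` (seat prover-pub-hodgecm2-b23-g52-0, binder prover b23, gen 52; claim «SYLOW TRANSFER XII + THE SHEARED DIHEDRAL FAMILY»,
HOME/INBOX.md l.23708).  One bookkeeping definition with body (the target-side pattern map `qS`, shaped as gen 44ʼs `qT`) + theorems, on part VI
(`Census/ShearedDihedralEquivariance.lean`) and gen 44ʼs `Census/QuarticInversionValues.lean` (`Avec`, `binVec`, `ind₁`, `ind₁_perm`) BY NAME; no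
`decide` beyond `Bool`/`Fin 4` literals, no certificate, no named fact, no `sorry`.  `Interfaces.lean` (C1), every E term, B01, `Transposition/*`,
`PortJoin/*`, `D2Bridge/*` untouched.
HONEST FRAMING: `HC_CM` is NOT proved, here or anywhere in the tree; nothing here is a period, a count of record or a headline.
-/
import Summits.HodgeConjecture.CorCM.Census.ShearedDihedralEquivariance
import Summits.HodgeConjecture.CorCM.Census.QuarticInversionValues

/-!
# The sheared dihedral family, XI: atom and constant values, and binomial value vectors, on `s`-translates

Word for word gen 44ʼs part IX §§2–4 for `t`, with `twS`/`translS`, the mask `bS = {1, 3}` and the pattern maps `pS` (part VI) and **`qS`**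
(`(qS h) n = h (σT n) ⊻ bS n`):
* **`fnl_wA_translS`**, **`fnl_wC_translS`** — the atom and constant functionals of an `s`-translate;
* **`Avec_translS_of_binVec`** — an exponent vector whose value vector is a slot binomial at coordinate `j` keeps a slot binomial at `σT j`, same
  slot, patterns moved by `qS` (complemented and swapped on the mask) — the `s`-input of gen 44ʼs orbit file (part XIII there).
All [folklore].

## References
* [Pohlmann1968] H. Pohlmann, Algebraic cycles on abelian varieties of complex multiplication type, Ann. of Math. 88 (1968), Thm 1.
-/

namespace Summit.HodgeConjecture.CorCM.Census.ShearedDihedral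

open Finset
open Summit.HodgeConjecture.CorCM.Census.OddSliceFacesModel
open Summit.HodgeConjecture.CorCM.Census.QuarticInversion

noncomputable section

variable (A : Type) [AddCommGroup A] [Fintype A] [DecidableEq A]

/-! ## §1 Atom and constant values on `s`-translates -/

/-- **Atom values on an `s`-translate.** [folklore] -/
theorem fnl_wA_translS (hA : Odd (Fintype.card A)) (j : Fin 4) (η : Fin 4 → Bool) (s : A) (v : Ty₄ A → ℤ) :
    fnl A (wA A j η s) (translS A v) =
      if bS j then -fnl A (wA A (σT j) (fun n => !pS η n) s) v else fnl A (wA A (σT j) (pS η) s) v := by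
  rw [fnl_translS]
  cases hb : bS j
  · have hw : (wA A j η s ∘ twS A) = wA A (σT j) (pS η) s := by
      funext Θ; simp only [Function.comp, wA_twS A hA, hb]; rfl
    rw [if_neg (by decide), hw]
  · have hw : (wA A j η s ∘ twS A) = (wA A (σT j) (fun n => !pS η n) s ∘ conj₄ A) := by
      funext Θ; simp only [Function.comp, wA_twS A hA, hb, if_true]
    rw [if_pos rfl, hw, fnl_comp_conj₄]

/-- **Constant values on an `s`-translate.** [folklore] -/
theorem fnl_wC_translS (hA : Odd (Fintype.card A)) (η : Fin 4 → Bool) (v : Ty₄ A → ℤ) :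
    fnl A (wC A η) (translS A v) = fnl A (wC A (pS η)) v := by
  have hw : (wC A η ∘ twS A) = wC A (pS η) := by
    funext Θ; simp only [Function.comp, wC_twS A hA]
  rw [fnl_translS, hw]

/-! ## §2 Binomial value vectors on `s`-translates -/

/-- The pattern map of `s` on the target side: `(qS h) n = h (σT n) ⊻ bS n`. [folklore] -/
def qS (h : Fin 4 → Bool) : Fin 4 → Bool := fun n => xor (h (σT n)) (bS n)

/-- **Transport by `s`**: coordinate `σT j`, same slot, patterns moved by `qS` (complemented and swapped on the mask `bS`). [folklore] -/
theorem Avec_translS_of_binVec (hA : Odd (Fintype.card A)) {v : Ty₄ A → ℤ} {j : Fin 4} {h h' : Fin 4 → Bool} {u : A}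
    (hv : Avec A v = binVec A j h h' u) :
    Avec A (translS A v) =
      if bS (σT j) then binVec A (σT j) (qS (fun n => !h' n)) (qS (fun n => !h n)) u
      else binVec A (σT j) (qS h) (qS h') u := by
  funext i
  rcases i with ⟨j', η, s⟩ | η
  · rw [Avec_inl, fnl_wA_translS A hA]
    have hj : (σT j' = j) ↔ (j' = σT j) := by
      constructor
      · intro e; rw [← e, σT_σT]
      · intro e; rw [e, σT_σT]
    by_cases hb : bS j' = true
    · rw [if_pos hb, ← Avec_inl, hv, binVec_inl]
      by_cases hc : σT j' = j ∧ s = u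
      · obtain ⟨hc1, hc2⟩ := hc
        have hb' : bS (σT j) = true := by rw [← hc1, σT_σT]; exact hb
        rw [if_pos ⟨hc1, hc2⟩, if_pos hb', binVec_inl, if_pos ⟨hj.mp hc1, hc2⟩, ← hc1]
        show -(ind₁ (σT j') h (fun n => !pS η n) - ind₁ (σT j') h' (fun n => !pS η n)) = _
        unfold pS
        rw [ind₁_perm_not σT_σT, ind₁_perm_not σT_σT, σT_σT]
        show -(ind₁ j' (qS fun n => !h n) η - ind₁ j' (qS fun n => !h' n) η) = _
        ring
      · rw [if_neg hc, neg_zero]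
        have hc' : ¬ (j' = σT j ∧ s = u) := fun ⟨e1, e2⟩ => hc ⟨hj.mpr e1, e2⟩
        split_ifs with hb'
        · rw [binVec_inl, if_neg hc']
        · rw [binVec_inl, if_neg hc']
    · rw [if_neg hb, ← Avec_inl, hv, binVec_inl]
      by_cases hc : σT j' = j ∧ s = u
      · obtain ⟨hc1, hc2⟩ := hc
        have hb' : ¬ bS (σT j) = true := by rw [← hc1, σT_σT]; exact hb
        rw [if_pos ⟨hc1, hc2⟩, if_neg hb', binVec_inl, if_pos ⟨hj.mp hc1, hc2⟩, ← hc1]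
        unfold pS
        rw [ind₁_perm σT_σT, ind₁_perm σT_σT, σT_σT]
        rfl
      · rw [if_neg hc]
        have hc' : ¬ (j' = σT j ∧ s = u) := fun ⟨e1, e2⟩ => hc ⟨hj.mpr e1, e2⟩
        split_ifs with hb'
        · rw [binVec_inl, if_neg hc']
        · rw [binVec_inl, if_neg hc']
  · rw [Avec_inr, fnl_wC_translS A hA, ← Avec_inr, hv, binVec_inr]
    split_ifs <;> rw [binVec_inr]

end

end Summit.HodgeConjecture.CorCM.Census.ShearedDihedral
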